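import Literature.MathematicalPhysics.QuantumFieldTheory.Balaban1983to89.T4RecentScale
import Literature.MathematicalPhysics.QuantumFieldTheory.Balaban1983to89.T4FibreTranslate

/-!
# T4NestedLevels — the recent-scale sandwich of node U5b ONE LEVEL DOWN AND AT EVERY PENDING LEVEL: nested ledgers of
positive integral operations, the kernel-checked fact that the two-run sandwich bounds add over LEAVES ONLY (no
accumulation over the nesting depth), and the hand-off of nested terms to `T4RecentScale.density_sandwich` /
`goodTerm_sandwich` (cell `pub-balaban`, T4-DAG v4 §2 nodes U5 / U5d, §5 row T4-U5.E-c; typing + bookkeeping only)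

HONEST FRAMING (T4-DAG PAGE 1).  The cell's T4 target is rung (B)+1: existence AND uniqueness of the ε → 0 limit of
Bałaban's unit-scale averaged loop expectations on a FIXED finite torus — strictly beyond ultraviolet stability
([Balaban1988Convergent] Cor. 3 p. 264; [Balaban1989LargeFieldII] Thm 1 p. 355), NOT infinite volume, NOT a mass gap, NOT
the Clay problem.  Node U5 compares, term by term, the final-scale density expansions of TWO runs of the renormalization
group (run A: K steps from spacing ε; run B: K + 1 steps from ε/L) driven by the SAME unit-lattice field.  NOTHING OF THIS
COMPARISON IS PRINTED: the manuscripts under audit construct ONE run and bound its terms uniformly in ε.  This module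
therefore ASSERTS NOTHING about Bałaban's objects.  It extends the tree's one-level-down lemmas
(`T4RecentScale.factorSandwich_of_inner`, `factorLogBound_of_innerExp` — the abstract form of (1.73)–(1.75) below) to
the FULL NESTING of a term: a term of the final density carries pending positive integral operations which are
themselves ordered products of one-step operations over successive scales ((2.20) below), each containing sums over
sub-histories, integrals, characteristic functions and, recursively, the operations of older regions ((1.71), (1.100)
below).  The module (i) types such a term as a NESTED LEDGER (`Ledger`: leaves = factors; nodes = products, finite sums,
and applications of abstract positive integral operations `PosOp`, of which the iterated integral `MeasureTheory.lmarginal`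
— hence the tree's `B15.BasicStep.fibreIntegral` — is an instance), (ii) kernel-checks ([folklore]) that a zero-tolerant
two-sided pointwise sandwich of every LEAF between the two runs (`Ledger.Matched`) passes to the ROOT with lower/upper
log-bounds that are sums over the leaves and IGNORE the operation nodes (`Ledger.sandwiched_eval`, `Ledger.lower`,
`Ledger.upper`, `Ledger.width_le_leafSum`) — the typed content of the row's clause "so that the inner sandwich constants
do not accumulate over the ≤ n_recent pending levels" — and (iii) delivers the root sandwich in EXACTLY the shapes
consumed upstream: `T4RecentScale.FactorSandwich` for a family of nested blocks used as factors of an outer term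
(`factorSandwich_of_nested`, the hypothesis of `T4RecentScale.density_sandwich`) and the good-class clause of the hybrid
lemma for one nested term (`goodTerm_sandwich_nested` ⇐ `T4RecentScale.goodTerm_sandwich`).  Run B's extra finest level
(node U5d) and an unsynchronised threshold shell one level down (the row's why-it-might-fail) are typed at LEAF level as
one-sided / two-sided extra nonnegative mass (`Sandwiched.of_extra`, `Sandwiched.of_shell`) — NAMED hypothesis shapes in
the design of the tree's top-level `T4IndicatorShell` (row T4-U5b.E2), NOT estimates.  The estimates themselves (the
per-leaf bounds at inner levels, the relative masses, the synchronisation of inner radii = node U5a at every pending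
level) are beyond kernel reach and NOT in print; the paper-level record with every printed input cited by page is the
cell file `t4/T4-EST-U5Ec.md`.  Value = typed hypothesis shapes with exact quantifier order + kernel bookkeeping of an
implication ⇐ named inputs; NOT summit progress.

Printed context (verbatim, read on the ×2 journal-page renders by this seat; the manuscripts under audit are quoted for
CONTEXT only — no disputed step of theirs is used anywhere below).
* THE NESTING.  [Balaban1988Convergent] p. 258: *"The last large field region is Z_k, and 𝐓_k is supported in it, in the
  sense that it involves integrations and variables restricted to this region. If Z_k is represented as a union of
  disjoint regions, e.g. as a union of connected components, Z_k = X_1 ∪ .... ∪ X_n, X_i ∩ X_j = ∅ for i ≠ j, then 𝐓_k(Z_k) =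
  Π_{i=1}^n 𝐓_k(X_i). (2.19) The operations corresponding to disjoint regions commute, i.e., 𝐓_k(X_i)𝐓_k(X_j) =
  𝐓_k(X_j)𝐓_k(X_i). For a given large field region X the operation 𝐓_k(X) can be factorized into a product of one-step
  operations, and has the form 𝐓_k(X) = Π_{j=k−1}^{0} 𝐓^{(j)}(Z_{j+1} ∩ X). (2.20) This is an ordered product, the order
  indicated in the product symbol. The operation 𝐓^{(j)} involves integration with respect to the gauge field variables
  V_j on Ω^c_{j+1} ∩ X, and with respect to the fluctuation field variables A_j on Z_{j+1} ∩ Ω_{j+1} ∩ X, if the last set is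
  nonempty."*; (2.21) displays 𝐓^{(j)}(Z_{j+1} ∩ X) as `∫dV_j⌈… δ(V̄_j V_{j+1}^{−1}) ζ(Ω^c_{j+1}) · ∫dA_j⌈… χ(Z_{j+1} ∩ Ω_{j+1} ∩ X)
  exp[−½⟨A_j, C*Δ^{(j)}CA_j⟩ + ½⟨A_j, C*Δ^{(j)}CC^{(j)}(Λ_{j+1})C*Δ^{(j)}CA_j⟩]`; *"If the operation 𝐓^{(j)} is changed by an
  𝐑-operation, then the general form (2.21) is preserved, but the characteristic functions are changed"*; *"We will use
  the factorization (2.20) in the form 𝐓_k(X) = Π_{j=k−1}^{m} 𝐓^{(j)}(Z_{j+1} ∩ X)𝐓_m(Z_m ∩ X), (2.22) and in the case where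
  the last k − m operations have the form (2.21)."*  [Balaban1988Convergent, (2.19)–(2.22) p.258]
* ONE PENDING OPERATION WITH ITS INNER SUMS, INTEGRALS, INDICATORS AND RECURSION.  [Balaban1989LargeFieldII] pp. 378–379
  (1.71): `𝐓′_k(X) = (2^d d!)^{−1} Σ_{{Ω^c_j ∩ X, Z_j ∩ X}, r} ∫dB⌈_X σ(g_kB)δ_{rT}(B)χ′(X) · ∫dV_h⌈_{(Ω″^{~2}_{h+1})^c ∩ X}
  χ_{h,1/2}((Ω″^~_{h+1})^c ∩ Ω_h ∩ X)𝐓_h(Z_h ∩ X) · exp[−½⟨DH″_{1,k,X}B, ζDH″_{1,k,X}B⟩ − A((g″_k(·))^{−2}ζ_1Γ_X,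
  U″_{h+2}(exp ig_kB, V″)) + V(X~, U_k) + E_k(X) + (−½d(𝔤)log g_k^{−2} + log σ_0)|(𝐁_0∖T_0) ∩ X| − E_k(Λ ∩ X)]`; p. 379: *"All
  the expressions in the above integral operation are localized in the domain X."* and *"the sum in the definition
  (1.71) acts also on the last exponential in (1.72)."*  [Balaban1989LargeFieldII, (1.71) pp.378–379]
* THE PRINTED ONE-LEVEL MECHANISM (positivity + sup-norm).  [Balaban1989LargeFieldII] pp. 379–380: *"All the expressions
  in the definition (1.71), for the configuration U, are real, and the exponential density in the integral is positive.
  This implies the inequalities |𝐓′_k(X,(𝐔,𝐉))F| = |𝐓′_k(X,(U,0))e^σF| ≤ 𝐓′_k(X,(U,0))|e^σF| ≤ (𝐓′_k(X,(U,0))1) sup e^{|σ|}|F|,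
  (1.73) […] The expression 𝐓′_k(X,(U,0))1 is obviously positive, although it may be very small, hence 𝐓′_k(X,(𝐔,𝐉))1 ≠ 0,
  and from the above inequalities we obtain |(𝐓′_k(X,(𝐔,𝐉))1)^{−1}𝐓′_k(X,(𝐔,𝐉))F| ≤ e^{3 sup|σ|} sup|F|. (1.75)"*; p. 380:
  *"In effect we get a bound, to which every large field domain Z_j contributes the constant O(1) log g_j^{−2}|Z_j|"* (the
  constants inside a pending operation are SUB-HISTORY DEPENDENT — the reason finite-sum nodes below take the hull of
  their children's bounds, `Ledger.lower`/`upper` at `add`).  [Balaban1989LargeFieldII, (1.73)–(1.75) p.380]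
* THE SAME NESTING INSIDE THE BASIC RENORMALISATION OPERATION.  [Balaban1989LargeFieldI] p. 201 (1.100) contains, per
  component X_i, the factor `∫dV_h⌈_{(Ω″^{~2}_{i,h+1})^c} χ_{h,1/2}((Ω″^~_{i,h+1})^c ∩ Ω_{i,h})𝕋_h(Z_{i,h}) ∫dV′⌈_{𝔹_i}δ_{T_i}(V′)χ′_i`
  next to the inserted quotient `δ_{G_i}(V′_k)χ(Λ_i)exp[−g_k^{−2}A(ζ_i, U_{k,X_i}(V′_kV_{Λ_i}))] / ∫dV′⌈_{Λ_i}δ_{G_i}(V′)χ(Λ_i)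
  exp[−g_k^{−2}A(ζ_i, U_{k,X_i}(V′V_{Λ_i}))]`; same page: *"The operation 𝕋″_k above includes a summation over all possible
  forms of this operation in various components of Z_k∖Z."*, *"the remaining summations, which are factorized in those
  domains"* and *"The above operation has the fundamental normalization property ∫dV_k(ℝ′ρ_k)(V_k) = ∫dV_kρ_k(V_k).
  (1.102)"*.  [Balaban1989LargeFieldI, (1.100)–(1.102) p.201]

## What is typed and what is proved

§1 `Sandwiched lo hi a b` [folklore]: the zero-tolerant two-sided relation `e^{lo}·a ≤ b ≤ e^{hi}·a` in `ℝ≥0∞` (so that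
`a = b = 0` — an IDENTICAL characteristic function vanishing in both runs — is sandwiched with any bounds, and no
integrability side condition is ever needed); its algebra: `zero`, `rfl_of` (identical factors), `mono`, `mul`, `add`
(hull of the bounds), `sum`, `lintegral` (a.e. hypotheses), `toReal`/`ofReal` (dictionary with the real-valued shapes of
`T4RecentScale`, `c − r = lo`, `c + r = hi`), `sandwich_div` (a QUOTIENT — the inserted factor of (1.100) — costs
numerator width PLUS denominator width: no cancellation is claimed, GAPS G-pv16g4-4 (d)).
§2 `PosOp W` [folklore]: an abstract POSITIVE INTEGRAL OPERATION on nonnegative functions of one configuration space `W`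
(all variables of all levels of both runs) — monotone and commuting with finite scalars; B16's sentence *"the exponential
density in the integral is positive. This implies the inequalities (1.73)"* is exactly monotonicity + homogeneity.
`PosOp.sandwiched`: a common operation applied in both runs preserves `Sandwiched lo hi` with the SAME bounds.  Instances:
`PosOp.kernel` (∫ f(Φ w x) dν_w(x), any w-dependent COMMON measure), `PosOp.marginal` = `MeasureTheory.lmarginal`
(`marginal_op`, by `rfl`), and the tree's restricted Haar integral `B15.BasicStep.fibreIntegral s f = toReal ∘ (marginal
op) ∘ ofReal` (`fibreIntegral_eq_marginal`, by `rfl`); additivity of the marginal instance for measurable integrands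
(`marginal_op_add`, used to split an inner integrand into core + shell / matched + extra pieces).
§3 `Ledger ι O` [folklore]: the nested ledger (leaf / mul / add / app) with two-run evaluation `Ledger.eval T f`, leaf
bookkeeping `leaves`, `leafSum`, `depth`, computed root bounds `lower l` / `upper u` (sum at `mul`, min / max at `add`,
UNCHANGED at `app`), the pointwise matching predicate `Matched` (leaf: `Sandwiched`; `mul`: both children matched OR both
runs' products vanish at the point — the off-admissible-set device of `T4RecentScale.density_sandwich` at every level;
`add`: both; `app`: the child matched at EVERY point of `W`), and THE THEOREM `sandwiched_eval`: matched everywhere ⇒ the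
root values are `Sandwiched (lower l t) (upper u t)` everywhere.  NO ACCUMULATION: `lower_eq_leafSum`/`upper_eq_leafSum`
(sum-free ledgers: the bounds are EXACTLY the leaf sums, whatever the depth), `leafSum_le_lower`/`upper_le_leafSum` and
`width_le_leafSum` (general ledgers with sign-normalised leaf bounds: the root width is at most the sum of the leaf widths)
— contrast (1.75), whose constant e^{3 sup|σ|} is PER LEVEL and would compound over the nesting depth, which grows with
the number N of pending levels.  FLATTENED MULTIPLICITY: `leafSum_eq_sum_toFinset` + `leafSum_rate_le_crossoverShape` — the
leaves of ALL levels form ONE flat ledger to which `T4RecentScale.Multiplicity` / `sum_rate_le_crossoverShape` apply (so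
the multiplicity hypothesis of node U5.E must be stated for the flattened ledger, inner levels included).
§4 HAND-OFF [folklore]: `toReal_sandwich_of_matched`, `density_sandwich_nested` ((c, r)-form for sum-free ledgers),
`factorSandwich_of_nested` (nested blocks as factors of an outer term: the `FactorSandwich` hypothesis of
`T4RecentScale.density_sandwich`, constants `leafSum c`, remainders `leafSum r`), `goodTerm_sandwich_nested` (one nested
term straight into the good-class clause of `T4WeightBudget.hybridSandwich_of_relWeightBound` via
`T4RecentScale.goodTerm_sandwich`).
§5 LEAF-LEVEL ASYMMETRIES [folklore]: `Sandwiched.of_extra` (node U5d: run B's block carries EXTRA nonnegative mass — its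
finest-level large-field sub-histories, which have no run-A counterpart — of relative size ≤ ω: the upper bound widens by
log(1 + ω), the lower bound is untouched), `Sandwiched.of_shell` (an unsynchronised threshold one level down: each run's
inner integrand = common core + its own shell piece of relative mass ≤ ω_A resp. ω_B — the one-level-down analogue of
`T4IndicatorShell.ShellWeightBound`; with node U5a's common radii at every pending level the shells are EMPTY and the
indicator leaves are identical, `Matched` by `Sandwiched.rfl_of`), `SyncLeaves` (the U5a clause at all levels as a
binder: identical leaf values on a designated set of indicator / δ / measure-density leaves).

Deliberately NOT here: any statement about Bałaban's densities, 𝐓/𝐓′/𝕋-operations, inserts, E/R/B-terms or histories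
(every shape is a hypothesis to be assumed by node U5.E, never used as a fact); the per-leaf estimates at inner levels
(cell NE2/NE3/NE5/NE9/NE10 one level down, `T4RecentScale.FactorLogRatio`); the relative masses ω (node U5c's weights at
the finest slice; the inner shell mass — NOT PRINTED: at a threshold shell B16 offers only the small factor it extracts
there, p. 383); the synchronisation (tree `T4SyncThresholds`); integrability / finiteness of the real densities
(hypotheses `hA`, `hB`, `hintA`, `hintB` below); the top-level common-refinement of `T4IndicatorShell`.  Every `theorem` is
[folklore] (elementary order arithmetic in `ℝ≥0∞` / `ℝ`, monotonicity of the Lebesgue integral, structural induction);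
0 sorry; nothing about the continuum limit is claimed.  Cell GAPS C-b01g8-1, G-b01g8-1…4; unit b2b-balaban-b01-g8 (claim T4-U5.E-c,
T4-DAG v4 §5).
-/

open scoped BigOperators ENNReal
open _root_.MeasureTheory Function Finset

namespace Literature.MathematicalPhysics.QuantumFieldTheory.Balaban1983to89.T4NestedLevels

noncomputable section

/-! ## §1 The zero-tolerant two-sided sandwich in `ℝ≥0∞` -/

section Sandwich

/-- `Sandwiched lo hi a b`: `e^{lo}·a ≤ b ≤ e^{hi}·a` in `ℝ≥0∞` — the two runs' values `a` (run A) and `b` (run B) of one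
factor / block at one configuration, with LOWER and UPPER log-bounds (`lo = c − r`, `hi = c + r` in the notation of
`T4RecentScale.FactorSandwich`).  Zero-tolerant: `a = b = 0` is sandwiched with any bounds. [folklore] -/
def Sandwiched (lo hi : ℝ) (a b : ℝ≥0∞) : Prop :=
  ENNReal.ofReal (Real.exp lo) * a ≤ b ∧ b ≤ ENNReal.ofReal (Real.exp hi) * a

namespace Sandwiched

variable {lo hi lo' hi' lo₁ hi₁ lo₂ hi₂ : ℝ} {a b a₁ b₁ a₂ b₂ : ℝ≥0∞}

/-- Both runs' values vanish (an identical characteristic function is `0` at the configuration). [folklore] -/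
theorem zero : Sandwiched lo hi 0 0 := by simp [Sandwiched]

/-- IDENTICAL values in the two runs (node U5a's synchronised indicators, δ-functions, common measure densities) are
sandwiched with any bounds `lo ≤ 0 ≤ hi`. [folklore] -/
theorem rfl_of (hlo : lo ≤ 0) (hhi : 0 ≤ hi) (a : ℝ≥0∞) : Sandwiched lo hi a a := by
  constructor
  · calc ENNReal.ofReal (Real.exp lo) * a ≤ 1 * a :=
          mul_le_mul' (ENNReal.ofReal_le_one.mpr (Real.exp_le_one_iff.mpr hlo)) le_rfl
      _ = a := one_mul a
  · calc a = 1 * a := (one_mul a).symm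
      _ ≤ ENNReal.ofReal (Real.exp hi) * a :=
          mul_le_mul' (ENNReal.one_le_ofReal.mpr (Real.one_le_exp_iff.mpr hhi)) le_rfl

/-- Weakening the bounds. [folklore] -/
theorem mono (h : Sandwiched lo hi a b) (hlo : lo' ≤ lo) (hhi : hi ≤ hi') : Sandwiched lo' hi' a b := by
  constructor
  · exact (mul_le_mul' (ENNReal.ofReal_le_ofReal (Real.exp_le_exp.mpr hlo)) le_rfl).trans h.1
  · exact h.2.trans (mul_le_mul' (ENNReal.ofReal_le_ofReal (Real.exp_le_exp.mpr hhi)) le_rfl)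

/-- PRODUCTS: bounds add (`T4HybridMatching.prod_sandwich` for two factors, in `ℝ≥0∞`). [folklore] -/
theorem mul (h₁ : Sandwiched lo₁ hi₁ a₁ b₁) (h₂ : Sandwiched lo₂ hi₂ a₂ b₂) :
    Sandwiched (lo₁ + lo₂) (hi₁ + hi₂) (a₁ * a₂) (b₁ * b₂) := by
  constructor
  · rw [Real.exp_add, ENNReal.ofReal_mul (Real.exp_nonneg _), mul_mul_mul_comm]
    exact mul_le_mul' h₁.1 h₂.1
  · rw [Real.exp_add, ENNReal.ofReal_mul (Real.exp_nonneg _), mul_mul_mul_comm]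
    exact mul_le_mul' h₁.2 h₂.2

/-- FINITE SUMS of blocks with DIFFERENT bounds (sub-histories inside one pending operation carry sub-history dependent
constants, p. 380): the sum is sandwiched with the HULL of the bounds. [folklore] -/
theorem add (h₁ : Sandwiched lo₁ hi₁ a₁ b₁) (h₂ : Sandwiched lo₂ hi₂ a₂ b₂) :
    Sandwiched (min lo₁ lo₂) (max hi₁ hi₂) (a₁ + a₂) (b₁ + b₂) := by
  have h₁' := h₁.mono (min_le_left lo₁ lo₂) (le_max_left hi₁ hi₂)
  have h₂' := h₂.mono (min_le_right lo₁ lo₂) (le_max_right hi₁ hi₂)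
  constructor
  · rw [mul_add]; exact add_le_add h₁'.1 h₂'.1
  · rw [mul_add]; exact add_le_add h₁'.2 h₂'.2

/-- Finite sums with COMMON bounds. [folklore] -/
theorem sum {κ : Type*} {S : Finset κ} {f g : κ → ℝ≥0∞} (h : ∀ k ∈ S, Sandwiched lo hi (f k) (g k)) :
    Sandwiched lo hi (∑ k ∈ S, f k) (∑ k ∈ S, g k) := by
  constructor
  · rw [Finset.mul_sum]; exact Finset.sum_le_sum fun k hk => (h k hk).1
  · rw [Finset.mul_sum]; exact Finset.sum_le_sum fun k hk => (h k hk).2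

/-- Scaling both runs by a COMMON nonnegative factor. [folklore] -/
theorem smul (h : Sandwiched lo hi a b) (m : ℝ≥0∞) : Sandwiched lo hi (m * a) (m * b) := by
  constructor
  · rw [mul_left_comm]; exact mul_le_mul' le_rfl h.1
  · rw [mul_left_comm]; exact mul_le_mul' le_rfl h.2

/-- INTEGRALS against a COMMON measure: an a.e. pointwise sandwich of the integrands passes to the Lebesgue integrals with
the SAME bounds — the `ℝ≥0∞` form of `T4HybridMatching.integral_sandwich`, with NO integrability side condition.  This is
the content of (1.73): *"the exponential density in the integral is positive. This implies the inequalities"*.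
[folklore] -/
theorem lintegral {α : Type*} [MeasurableSpace α] {μ : Measure α} {f g : α → ℝ≥0∞}
    (h : ∀ᵐ x ∂μ, Sandwiched lo hi (f x) (g x)) :
    Sandwiched lo hi (∫⁻ x, f x ∂μ) (∫⁻ x, g x ∂μ) := by
  constructor
  · rw [← lintegral_const_mul' _ _ ENNReal.ofReal_ne_top]
    exact lintegral_mono_ae (h.mono fun x hx => hx.1)
  · rw [← lintegral_const_mul' _ _ ENNReal.ofReal_ne_top]
    exact lintegral_mono_ae (h.mono fun x hx => hx.2)

/-- DICTIONARY (→ ℝ): for finite values the relation is the real two-sided sandwich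
`e^{lo}·a ≤ b ≤ e^{hi}·a` of `T4RecentScale` (`lo = c − r`, `hi = c + r`). [folklore] -/
theorem toReal (h : Sandwiched lo hi a b) (ha : a ≠ ∞) (hb : b ≠ ∞) :
    Real.exp lo * a.toReal ≤ b.toReal ∧ b.toReal ≤ Real.exp hi * a.toReal := by
  constructor
  · have := ENNReal.toReal_mono hb h.1
    rwa [ENNReal.toReal_mul, ENNReal.toReal_ofReal (Real.exp_nonneg _)] at this
  · have := ENNReal.toReal_mono (ENNReal.mul_ne_top ENNReal.ofReal_ne_top ha) h.2
    rwa [ENNReal.toReal_mul, ENNReal.toReal_ofReal (Real.exp_nonneg _)] at this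

/-- DICTIONARY (← ℝ): a real two-sided sandwich of two nonnegative reals gives the relation for their `ofReal`'s (how a
leaf bound obtained from `T4RecentScale.FactorSandwich` / `FactorLogBound.sandwich` enters a nested ledger). [folklore] -/
theorem ofReal {x y : ℝ} (hl : Real.exp lo * x ≤ y) (hu : y ≤ Real.exp hi * x) :
    Sandwiched lo hi (ENNReal.ofReal x) (ENNReal.ofReal y) := by
  constructor
  · rw [← ENNReal.ofReal_mul (Real.exp_nonneg _)]; exact ENNReal.ofReal_le_ofReal hl
  · rw [← ENNReal.ofReal_mul (Real.exp_nonneg _)]; exact ENNReal.ofReal_le_ofReal hu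

end Sandwiched

/-- QUOTIENTS (the inserted factor of (1.100): a positive function over its own fibre integral, in each run): numerator
sandwiched with `(lo₁, hi₁)` and denominator with `(lo₂, hi₂)` give the quotient sandwiched with `(lo₁ − hi₂, hi₁ − lo₂)` —
the widths ADD; no cancellation between numerator and denominator is claimed or printed (cell GAPS G-pv16g4-4 (d)).
Real form, positive denominators. [folklore] -/
theorem sandwich_div {lo₁ hi₁ lo₂ hi₂ a₁ b₁ a₂ b₂ : ℝ} (ha₁ : 0 ≤ a₁) (ha₂ : 0 < a₂) (hb₂ : 0 < b₂)
    (h₁l : Real.exp lo₁ * a₁ ≤ b₁) (h₁u : b₁ ≤ Real.exp hi₁ * a₁)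
    (h₂l : Real.exp lo₂ * a₂ ≤ b₂) (h₂u : b₂ ≤ Real.exp hi₂ * a₂) :
    Real.exp (lo₁ - hi₂) * (a₁ / a₂) ≤ b₁ / b₂ ∧ b₁ / b₂ ≤ Real.exp (hi₁ - lo₂) * (a₁ / a₂) := by
  have hb₁ : 0 ≤ b₁ := (mul_nonneg (Real.exp_nonneg _) ha₁).trans h₁l
  have hea₂ : 0 < Real.exp hi₂ * a₂ := mul_pos (Real.exp_pos _) ha₂
  have hea₂' : 0 < Real.exp lo₂ * a₂ := mul_pos (Real.exp_pos _) ha₂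
  constructor
  · rw [Real.exp_sub, div_mul_div_comm]
    calc Real.exp lo₁ * a₁ / (Real.exp hi₂ * a₂) ≤ b₁ / (Real.exp hi₂ * a₂) :=
          div_le_div_of_nonneg_right h₁l hea₂.le
      _ ≤ b₁ / b₂ := div_le_div_of_nonneg_left hb₁ hb₂ h₂u
  · rw [Real.exp_sub, div_mul_div_comm]
    calc b₁ / b₂ ≤ Real.exp hi₁ * a₁ / b₂ := div_le_div_of_nonneg_right h₁u hb₂.le
      _ ≤ Real.exp hi₁ * a₁ / (Real.exp lo₂ * a₂) :=
          div_le_div_of_nonneg_left (mul_nonneg (Real.exp_nonneg _) ha₁) hea₂' h₂l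

end Sandwich

/-! ## §2 Abstract positive integral operations -/

section PosOp

/-- A POSITIVE INTEGRAL OPERATION on nonnegative functions of the configuration space `W` (all variables of all levels):
monotone and commuting with finite scalars — the two properties B16 uses in (1.73) (*"the exponential density in the
integral is positive. This implies the inequalities"*).  The SAME operation acts in both runs (node U5a's common radii /
common measures, cell record X-16 D3/D4): run-dependent densities are LEAVES, not part of the operation. [folklore] -/
structure PosOp (W : Type*) where
  /-- the operation -/
  op : (W → ℝ≥0∞) → (W → ℝ≥0∞)
  /-- positivity: monotone -/
  mono : ∀ ⦃f g : W → ℝ≥0∞⦄, f ≤ g → op f ≤ op g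
  /-- homogeneity for finite scalars -/
  smul : ∀ (m : ℝ≥0∞), m ≠ ∞ → ∀ f : W → ℝ≥0∞, op (fun w => m * f w) = fun w => m * op f w

namespace PosOp

variable {W : Type*}

/-- A COMMON positive integral operation applied in both runs preserves the sandwich with the SAME bounds — the
operation node contributes NOTHING to the bounds (abstract form of `T4RecentScale.factorSandwich_of_inner`). [folklore] -/
theorem sandwiched (T : PosOp W) {lo hi : ℝ} {f g : W → ℝ≥0∞} (h : ∀ w, Sandwiched lo hi (f w) (g w)) (w : W) :
    Sandwiched lo hi (T.op f w) (T.op g w) := by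
  constructor
  · have h1 : T.op (fun w => ENNReal.ofReal (Real.exp lo) * f w) ≤ T.op g := T.mono fun w => (h w).1
    have h2 := h1 w
    rw [T.smul _ ENNReal.ofReal_ne_top f] at h2
    exact h2
  · have h1 : T.op g ≤ T.op (fun w => ENNReal.ofReal (Real.exp hi) * f w) := T.mono fun w => (h w).2
    have h2 := h1 w
    rw [T.smul _ ENNReal.ofReal_ne_top f] at h2
    exact h2

/-- INSTANCE: a kernel operation `(op f)(w) = ∫ f(Φ w x) dν_w(x)` — integration of the configuration's inner variables
against a COMMON (possibly w-dependent) measure, the substitution `Φ` inserting the integration variables into the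
configuration. [folklore] -/
def kernel {X : Type*} [MeasurableSpace X] (ν : W → Measure X) (Φ : W → X → W) : PosOp W where
  op f w := ∫⁻ x, f (Φ w x) ∂(ν w)
  mono _ _ hfg := fun w => lintegral_mono fun x => hfg (Φ w x)
  smul m hm f := by
    funext w
    exact lintegral_const_mul' m (fun x => f (Φ w x)) hm

/-- INSTANCE: the iterated marginal integral `MeasureTheory.lmarginal μ s` over the coordinates `s` of a product
configuration space (product Haar over the bond variables of a region, (2.21); Lebesgue on a common box, (1.71)).
[folklore] -/
def marginal {δ : Type*} [DecidableEq δ] {π : δ → Type*} [∀ d, MeasurableSpace (π d)]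
    (μ : ∀ d, Measure (π d)) (s : Finset δ) : PosOp (∀ d, π d) :=
  kernel (fun _ => Measure.pi fun d : s => μ d) (fun w y => updateFinset w s y)

/-- `marginal μ s` IS `∫⋯∫⁻_s · ∂μ`. [folklore] -/
theorem marginal_op {δ : Type*} [DecidableEq δ] {π : δ → Type*} [∀ d, MeasurableSpace (π d)]
    (μ : ∀ d, Measure (π d)) (s : Finset δ) (f : (∀ d, π d) → ℝ≥0∞) :
    (marginal μ s).op f = ∫⋯∫⁻_s, f ∂μ := rfl

/-- Additivity of the marginal instance for a measurable first summand (used to split an inner integrand into matched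
core + extra / shell pieces, §5). [folklore] -/
theorem marginal_op_add {δ : Type*} [DecidableEq δ] {π : δ → Type*} [∀ d, MeasurableSpace (π d)]
    (μ : ∀ d, Measure (π d)) (s : Finset δ) {f : (∀ d, π d) → ℝ≥0∞} (hf : Measurable f) (g : (∀ d, π d) → ℝ≥0∞) :
    (marginal μ s).op (fun w => f w + g w) = fun w => (marginal μ s).op f w + (marginal μ s).op g w := by
  funext w
  exact lintegral_add_left (hf.comp measurable_updateFinset) _

end PosOp

section SetupLevel

variable {P : Params} {j : ℕ} {G : Type*} [GaugeGroup G] [MeasurableSpace G] [HaarData G]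
variable [DecidableEq (PBond P j)]

/-- THE TREE'S RESTRICTED HAAR INTEGRAL IS AN INSTANCE: `B15.BasicStep.fibreIntegral s f` (the paper's `∫dV⌈_{Z′} f`,
[Balaban1989LargeFieldI] (0.3) p. 176 / (1.100) p. 201) is `toReal` of the marginal operation over product Haar applied to
`ofReal ∘ f`. [folklore] -/
theorem fibreIntegral_eq_marginal (s : Finset (PBond P j)) (f : Density P j G) (V : GaugeField P j G) :
    B15.BasicStep.fibreIntegral s f V =
      ((PosOp.marginal (fun _ : PBond P j => (HaarData.haar : Measure G)) s).op
        (fun U => ENNReal.ofReal (f U)) V).toReal := rfl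

end SetupLevel

end PosOp

/-! ## §3 Nested ledgers and the propagation theorem -/

section Ledger

/-- A NESTED LEDGER of one term of the final density: `leaf i` = one factor (indicator, δ, measure density, exp of an
action / E / R / B / boundary piece, inserted quotient, pending NUMBER …); `mul` = product of factors or blocks ((2.18),
(1.72), (1.104)); `add` = one summand pair of a finite sum INSIDE a pending operation (over sub-histories
`{Ω^c_j ∩ X, Z_j ∩ X}` and coordinate maps `r`, (1.71); *"a summation over all possible forms of this operation"*, p. 201);
`app o t` = the positive integral operation labelled `o` applied to the block `t` (one-step operations (2.21), `∫dB⌈_X`,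
`∫dV_h⌈_…`, recursively `𝐓_h(Z_h ∩ X)` = (2.20) again).  Binary nodes; n-ary products / sums are iterated. [folklore] -/
inductive Ledger (ι O : Type*) where
  | leaf : ι → Ledger ι O
  | mul : Ledger ι O → Ledger ι O → Ledger ι O
  | add : Ledger ι O → Ledger ι O → Ledger ι O
  | app : O → Ledger ι O → Ledger ι O

namespace Ledger

variable {ι O W : Type*}

/-- EVALUATION of a ledger in ONE run: leaf values `f i : W → ℝ≥0∞`, operations `T o`. [folklore] -/
def eval (T : O → PosOp W) (f : ι → W → ℝ≥0∞) : Ledger ι O → W → ℝ≥0∞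
  | leaf i => f i
  | mul s t => fun w => eval T f s w * eval T f t w
  | add s t => fun w => eval T f s w + eval T f t w
  | app o t => (T o).op (eval T f t)

/-- The leaves of ALL levels, as one flat list (with multiplicity). [folklore] -/
def leaves : Ledger ι O → List ι
  | leaf i => [i]
  | mul s t => leaves s ++ leaves t
  | add s t => leaves s ++ leaves t
  | app _ t => leaves t

/-- Sum of a leaf quantity over the leaves of ALL levels. [folklore] -/
def leafSum (c : ι → ℝ) : Ledger ι O → ℝ
  | leaf i => c i
  | mul s t => leafSum c s + leafSum c t
  | add s t => leafSum c s + leafSum c t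
  | app _ t => leafSum c t

/-- Nesting depth = number of nested pending operations along the deepest branch (the number of pending levels of the
term, ≤ the recent window N of (1.71)/(2.22)). [folklore] -/
def depth : Ledger ι O → ℕ
  | leaf _ => 0
  | mul s t => max (depth s) (depth t)
  | add s t => max (depth s) (depth t)
  | app _ t => depth t + 1

/-- The computed LOWER log-bound of the root from leaf lower bounds `l`: additive at `mul`, minimum at `add`, UNCHANGED
at `app`. [folklore] -/
def lower (l : ι → ℝ) : Ledger ι O → ℝ
  | leaf i => l i
  | mul s t => lower l s + lower l t
  | add s t => min (lower l s) (lower l t)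
  | app _ t => lower l t

/-- The computed UPPER log-bound of the root from leaf upper bounds `u`: additive at `mul`, maximum at `add`, UNCHANGED
at `app`. [folklore] -/
def upper (u : ι → ℝ) : Ledger ι O → ℝ
  | leaf i => u i
  | mul s t => upper u s + upper u t
  | add s t => max (upper u s) (upper u t)
  | app _ t => upper u t

/-- Sum-free ledgers (no `add` node): the pure nesting of products and operations of ONE sub-history chain. [folklore] -/
def SumFree : Ledger ι O → Prop
  | leaf _ => True
  | mul s t => SumFree s ∧ SumFree t
  | add _ _ => False
  | app _ t => SumFree t

/-- THE POINTWISE MATCHING PREDICATE between the two runs (leaf values `fA`, `fB`; leaf bounds `l`, `u`): a leaf is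
matched at `w` iff its two values are `Sandwiched (l i) (u i)` there; a product iff both factors are matched at `w` OR
both runs' products VANISH at `w` (an identical indicator in the product is `0` — the off-admissible-set device of
`T4RecentScale.density_sandwich`, now at every level); a sum iff both summands are; an operation node iff its integrand
block is matched at EVERY configuration (the inner variables range over the whole fibre). [folklore] -/
def Matched (T : O → PosOp W) (fA fB : ι → W → ℝ≥0∞) (l u : ι → ℝ) : Ledger ι O → W → Prop
  | leaf i, w => Sandwiched (l i) (u i) (fA i w) (fB i w)
  | mul s t, w => (Matched T fA fB l u s w ∧ Matched T fA fB l u t w) ∨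
      (eval T fA (mul s t) w = 0 ∧ eval T fB (mul s t) w = 0)
  | add s t, w => Matched T fA fB l u s w ∧ Matched T fA fB l u t w
  | app _ t, _ => ∀ w', Matched T fA fB l u t w'

section Structural

variable (T : O → PosOp W) (fA fB : ι → W → ℝ≥0∞) (l u : ι → ℝ)

/-- Convenience: a product is matched where one of its blocks vanishes in BOTH runs. [folklore] -/
theorem matched_mul_of_left_zero {s : Ledger ι O} (t : Ledger ι O) {w : W} (hA : eval T fA s w = 0)
    (hB : eval T fB s w = 0) : Matched T fA fB l u (mul s t) w :=
  Or.inr ⟨by simp [eval, hA], by simp [eval, hB]⟩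

/-- Convenience: a product is matched where one of its blocks vanishes in BOTH runs. [folklore] -/
theorem matched_mul_of_right_zero (s : Ledger ι O) {t : Ledger ι O} {w : W} (hA : eval T fA t w = 0)
    (hB : eval T fB t w = 0) : Matched T fA fB l u (mul s t) w :=
  Or.inr ⟨by simp [eval, hA], by simp [eval, hB]⟩

/-- Convenience: a product of matched blocks is matched. [folklore] -/
theorem matched_mul_of_matched {s t : Ledger ι O} {w : W} (hs : Matched T fA fB l u s w)
    (ht : Matched T fA fB l u t w) : Matched T fA fB l u (mul s t) w :=
  Or.inl ⟨hs, ht⟩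

/-- **THE PROPAGATION THEOREM.**  If the ledger is matched at `w`, the two runs' values of the whole nested term at `w`
are sandwiched with the COMPUTED bounds `lower l t`, `upper u t` — to which the operation nodes contribute nothing.
[folklore] -/
theorem sandwiched_eval : ∀ (t : Ledger ι O) (w : W), Matched T fA fB l u t w →
    Sandwiched (t.lower l) (t.upper u) (eval T fA t w) (eval T fB t w)
  | leaf _, _, h => h
  | mul s t, w, h => by
      rcases h with ⟨hs, ht⟩ | ⟨h0A, h0B⟩
      · exact (sandwiched_eval s w hs).mul (sandwiched_eval t w ht)
      · show Sandwiched _ _ (eval T fA (mul s t) w) (eval T fB (mul s t) w)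
        rw [h0A, h0B]
        exact Sandwiched.zero
  | add s t, w, h => (sandwiched_eval s w h.1).add (sandwiched_eval t w h.2)
  | app o t, w, h => (T o).sandwiched (fun w' => sandwiched_eval t w' (h w')) w

/-! ### No accumulation over the nesting depth -/

/-- `leafSum` is the sum over the flat leaf list. [folklore] -/
theorem leafSum_eq_sum_map (c : ι → ℝ) : ∀ t : Ledger ι O, t.leafSum c = ((t.leaves).map c).sum
  | leaf i => by simp [leafSum, leaves]
  | mul s t => by simp [leafSum, leaves, leafSum_eq_sum_map c s, leafSum_eq_sum_map c t]
  | add s t => by simp [leafSum, leaves, leafSum_eq_sum_map c s, leafSum_eq_sum_map c t]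
  | app _ t => by simp [leafSum, leaves, leafSum_eq_sum_map c t]

/-- `leafSum` is additive in the leaf quantity. [folklore] -/
theorem leafSum_add (c d : ι → ℝ) : ∀ t : Ledger ι O, t.leafSum (fun i => c i + d i) = t.leafSum c + t.leafSum d
  | leaf _ => rfl
  | mul s t => by simp only [leafSum, leafSum_add c d s, leafSum_add c d t]; ring
  | add s t => by simp only [leafSum, leafSum_add c d s, leafSum_add c d t]; ring
  | app _ t => by simp only [leafSum, leafSum_add c d t]

/-- `leafSum` is subtractive in the leaf quantity (`lo = c − r`, `hi = c + r`). [folklore] -/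
theorem leafSum_sub (c d : ι → ℝ) : ∀ t : Ledger ι O, t.leafSum (fun i => c i - d i) = t.leafSum c - t.leafSum d
  | leaf _ => rfl
  | mul s t => by simp only [leafSum, leafSum_sub c d s, leafSum_sub c d t]; ring
  | add s t => by simp only [leafSum, leafSum_sub c d s, leafSum_sub c d t]; ring
  | app _ t => by simp only [leafSum, leafSum_sub c d t]

/-- `leafSum` is monotone in the leaf quantity. [folklore] -/
theorem leafSum_mono {c d : ι → ℝ} (h : ∀ i, c i ≤ d i) : ∀ t : Ledger ι O, t.leafSum c ≤ t.leafSum d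
  | leaf i => h i
  | mul s t => add_le_add (leafSum_mono h s) (leafSum_mono h t)
  | add s t => add_le_add (leafSum_mono h s) (leafSum_mono h t)
  | app _ t => leafSum_mono h t

/-- SUM-FREE LEDGERS: the lower bound is EXACTLY the sum of the leaf lower bounds — whatever the depth. [folklore] -/
theorem lower_eq_leafSum : ∀ t : Ledger ι O, t.SumFree → t.lower l = t.leafSum l
  | leaf _, _ => rfl
  | mul s t, h => by simp only [lower, leafSum, lower_eq_leafSum s h.1, lower_eq_leafSum t h.2]
  | add _ _, h => False.elim h
  | app _ t, h => lower_eq_leafSum t h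

/-- SUM-FREE LEDGERS: the upper bound is EXACTLY the sum of the leaf upper bounds — whatever the depth. [folklore] -/
theorem upper_eq_leafSum : ∀ t : Ledger ι O, t.SumFree → t.upper u = t.leafSum u
  | leaf _, _ => rfl
  | mul s t, h => by simp only [upper, leafSum, upper_eq_leafSum s h.1, upper_eq_leafSum t h.2]
  | add _ _, h => False.elim h
  | app _ t, h => upper_eq_leafSum t h

/-- GENERAL LEDGERS with sign-normalised leaf bounds (`l i ≤ 0`: inside a pending operation the sub-history dependent
constants do not quotient out, p. 380, and are part of the width): the computed lower bound is at least the sum of the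
leaf lower bounds (and is `≤ 0`). [folklore] -/
theorem leafSum_le_lower (hl : ∀ i, l i ≤ 0) : ∀ t : Ledger ι O, t.leafSum l ≤ t.lower l ∧ t.lower l ≤ 0
  | leaf i => ⟨le_rfl, hl i⟩
  | mul s t => by
      obtain ⟨hs, hs0⟩ := leafSum_le_lower hl s
      obtain ⟨ht, ht0⟩ := leafSum_le_lower hl t
      exact ⟨add_le_add hs ht, by simp only [lower]; linarith⟩
  | add s t => by
      obtain ⟨hs, hs0⟩ := leafSum_le_lower hl s
      obtain ⟨ht, ht0⟩ := leafSum_le_lower hl t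
      refine ⟨?_, (min_le_left _ _).trans hs0⟩
      simp only [leafSum, lower]
      rcases min_choice (lower l s) (lower l t) with h | h <;> rw [h] <;> linarith
  | app _ t => leafSum_le_lower hl t

/-- GENERAL LEDGERS with sign-normalised leaf bounds (`0 ≤ u i`): the computed upper bound is at most the sum of the
leaf upper bounds (and is `≥ 0`). [folklore] -/
theorem upper_le_leafSum (hu : ∀ i, 0 ≤ u i) : ∀ t : Ledger ι O, t.upper u ≤ t.leafSum u ∧ 0 ≤ t.upper u
  | leaf i => ⟨le_rfl, hu i⟩
  | mul s t => by
      obtain ⟨hs, hs0⟩ := upper_le_leafSum hu s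
      obtain ⟨ht, ht0⟩ := upper_le_leafSum hu t
      exact ⟨add_le_add hs ht, by simp only [upper]; linarith⟩
  | add s t => by
      obtain ⟨hs, hs0⟩ := upper_le_leafSum hu s
      obtain ⟨ht, ht0⟩ := upper_le_leafSum hu t
      refine ⟨?_, hs0.trans (le_max_left _ _)⟩
      simp only [leafSum, upper]
      rcases max_choice (upper u s) (upper u t) with h | h <;> rw [h] <;> linarith
  | app _ t => upper_le_leafSum hu t

/-- **NO ACCUMULATION**: with sign-normalised leaf bounds the WIDTH of the root sandwich is at most the sum over the
leaves of ALL levels of the leaf widths — a quantity blind to the nesting depth and to the number of operation nodes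
(contrast (1.75): a constant e^{3 sup∣σ∣} PER LEVEL). [folklore] -/
theorem width_le_leafSum (hl : ∀ i, l i ≤ 0) (hu : ∀ i, 0 ≤ u i) (t : Ledger ι O) :
    t.upper u - t.lower l ≤ t.leafSum (fun i => u i - l i) := by
  rw [leafSum_sub]
  linarith [(leafSum_le_lower l hl t).1, (upper_le_leafSum u hu t).1]

/-! ### Flattened multiplicity -/

/-- With distinct leaf labels the leaf sum is a `Finset.sum` over the FLAT leaf set — the form in which the slicing /
multiplicity lemmas of `T4RecentScale` apply to the leaves of ALL levels at once. [folklore] -/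
theorem leafSum_eq_sum_toFinset [DecidableEq ι] (c : ι → ℝ) {t : Ledger ι O} (h : t.leaves.Nodup) :
    t.leafSum c = ∑ i ∈ t.leaves.toFinset, c i := by
  rw [leafSum_eq_sum_map, List.sum_toFinset c h]

/-- **FLATTENED MULTIPLICITY ⇒ THE RATE BRANCH**: if the leaf remainders of ALL levels carry the pure rate profile
`r_i ≤ C θ^{sc i} w_i` and the FLAT leaf set satisfies `T4RecentScale.Multiplicity` (creation scales `≤ K`), the total
remainder of the nested term is at most `Cw · vol · Σ_{j+n=K} C θ^j Λ^n` (`T4RecentScale.sum_rate_le_crossoverShape`) —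
the multiplicity hypothesis of node U5.E must therefore be stated for the flattened ledger, inner levels included.
[folklore] -/
theorem leafSum_rate_le_crossoverShape [DecidableEq ι] {t : Ledger ι O} (hnd : t.leaves.Nodup) {sc : ι → ℕ}
    {w r : ι → ℝ} {Cw vol Λ C θ : ℝ} {K : ℕ} (hsc : ∀ i ∈ t.leaves.toFinset, sc i ≤ K) (hC : 0 ≤ C) (hθ : 0 ≤ θ)
    (hM : T4RecentScale.Multiplicity t.leaves.toFinset sc w Cw vol Λ K)
    (hr : ∀ i ∈ t.leaves.toFinset, r i ≤ C * θ ^ sc i * w i) :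
    t.leafSum r ≤ Cw * vol * ∑ p ∈ antidiagonal K, C * θ ^ p.1 * Λ ^ p.2 := by
  rw [leafSum_eq_sum_toFinset r hnd]
  exact (Finset.sum_le_sum hr).trans (T4RecentScale.sum_rate_le_crossoverShape hsc hC hθ hM)

end Structural

/-! ## §4 Hand-off to `T4RecentScale` -/

section Handoff

variable {T : O → PosOp W} {fA fB : ι → W → ℝ≥0∞} {l u c r : ι → ℝ}

/-- Real form of the root sandwich for finite values. [folklore] -/
theorem toReal_sandwich_of_matched {t : Ledger ι O} (hM : ∀ w, Matched T fA fB l u t w)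
    (hA : ∀ w, eval T fA t w ≠ ∞) (hB : ∀ w, eval T fB t w ≠ ∞) (w : W) :
    Real.exp (t.lower l) * (eval T fA t w).toReal ≤ (eval T fB t w).toReal ∧
      (eval T fB t w).toReal ≤ Real.exp (t.upper u) * (eval T fA t w).toReal :=
  (sandwiched_eval T fA fB l u t w (hM w)).toReal (hA w) (hB w)

/-- **THE NESTED DENSITY SANDWICH in (c, r)-form**: a sum-free nested term whose leaves (of ALL levels) are matched with
`lo_i = c_i − r_i`, `hi_i = c_i + r_i` has its two runs' values sandwiched, at EVERY configuration, with constant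
`Σ_leaves c_i` and remainder `Σ_leaves r_i` — the conclusion shape of `T4RecentScale.density_sandwich`, now for nested
terms, the remainder counted ONCE per leaf over the whole nesting tree. [folklore] -/
theorem density_sandwich_nested {t : Ledger ι O} (hfree : t.SumFree)
    (hM : ∀ w, Matched T fA fB (fun i => c i - r i) (fun i => c i + r i) t w)
    (hA : ∀ w, eval T fA t w ≠ ∞) (hB : ∀ w, eval T fB t w ≠ ∞) (w : W) :
    Real.exp (t.leafSum c - t.leafSum r) * (eval T fA t w).toReal ≤ (eval T fB t w).toReal ∧
      (eval T fB t w).toReal ≤ Real.exp (t.leafSum c + t.leafSum r) * (eval T fA t w).toReal := by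
  have h := toReal_sandwich_of_matched hM hA hB w
  rwa [lower_eq_leafSum _ t hfree, upper_eq_leafSum _ t hfree, leafSum_sub, leafSum_add] at h

/-- **OUTPUT = THE `FactorSandwich` HYPOTHESIS OF `T4RecentScale.density_sandwich` FOR NESTED FACTORS**: a family of
sum-free nested blocks `blk i'`, each matched everywhere with finite values, read along the driving field by `e : V → W`,
is a `FactorSandwich` family of real factors with constants `leafSum c (blk i')` and remainders `leafSum r (blk i')` (on
any admissible set). [folklore] -/
theorem factorSandwich_of_nested {ι' V : Type*} (Adm : Set V) (fac : Finset ι') (blk : ι' → Ledger ι O) (e : V → W)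
    (hfree : ∀ i' ∈ fac, (blk i').SumFree)
    (hM : ∀ i' ∈ fac, ∀ w, Matched T fA fB (fun i => c i - r i) (fun i => c i + r i) (blk i') w)
    (hA : ∀ i' ∈ fac, ∀ w, eval T fA (blk i') w ≠ ∞) (hB : ∀ i' ∈ fac, ∀ w, eval T fB (blk i') w ≠ ∞) :
    T4RecentScale.FactorSandwich Adm fac (fun i' v => (eval T fA (blk i') (e v)).toReal)
      (fun i' v => (eval T fB (blk i') (e v)).toReal) (fun i' => (blk i').leafSum c)
      (fun i' => (blk i').leafSum r) := by
  intro v _ i' hi'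
  have h := density_sandwich_nested (hfree i' hi') (hM i' hi') (hA i' hi') (hB i' hi') (e v)
  exact ⟨ENNReal.toReal_nonneg, h.1, h.2⟩

/-- **ONE NESTED TERM INTO THE GOOD CLASS OF THE HYBRID LEMMA** (`T4RecentScale.goodTerm_sandwich`): the nested density
sandwich at every driving field, integrability of the two real densities, the common-constant obligation
`∣Σ_leaves c_i − c₀∣ ≤ s` and the budget `Σ_leaves r_i + s ≤ vol·δ_K` give
`exp(c₀ − vol·δ_K)·∫F^A ≤ ∫F^B ≤ exp(c₀ + vol·δ_K)·∫F^A`. [folklore] -/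
theorem goodTerm_sandwich_nested {V : Type*} [MeasurableSpace V] {μ : Measure V} (e : V → W) {t : Ledger ι O}
    {c₀ s vol δK : ℝ} (hfree : t.SumFree)
    (hM : ∀ w, Matched T fA fB (fun i => c i - r i) (fun i => c i + r i) t w)
    (hA : ∀ w, eval T fA t w ≠ ∞) (hB : ∀ w, eval T fB t w ≠ ∞)
    (hintA : Integrable (fun v => (eval T fA t (e v)).toReal) μ)
    (hintB : Integrable (fun v => (eval T fB t (e v)).toReal) μ)
    (hs : |t.leafSum c - c₀| ≤ s) (hR : t.leafSum r + s ≤ vol * δK) :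
    Real.exp (c₀ - vol * δK) * ∫ v, (eval T fA t (e v)).toReal ∂μ ≤ ∫ v, (eval T fB t (e v)).toReal ∂μ ∧
      ∫ v, (eval T fB t (e v)).toReal ∂μ ≤ Real.exp (c₀ + vol * δK) * ∫ v, (eval T fA t (e v)).toReal ∂μ :=
  T4RecentScale.goodTerm_sandwich hintA hintB (fun _ => ENNReal.toReal_nonneg)
    (fun v => (density_sandwich_nested hfree hM hA hB (e v)).1)
    (fun v => (density_sandwich_nested hfree hM hA hB (e v)).2) hs hR

end Handoff

end Ledger

end Ledger

/-! ## §5 Leaf-level asymmetries: run B's extra finest level (node U5d) and an inner threshold shell -/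

section Leaves

namespace Sandwiched

variable {lo hi : ℝ} {a g x a₀ b₀ xA xB : ℝ≥0∞}

/-- **NODE U5d AT LEAF LEVEL — ONE-SIDED EXTRA MASS**: run A's value `a` of a block; run B's value of the corresponding
block is `g + x` where `g` (run B's block restricted to the finest-level sub-histories that DO correspond to run A's)
is sandwiched against `a`, and `x` (run B's finest-level large-field sub-histories inside the block — no run-A
counterpart) has relative mass `x ≤ ω·g` (node U5c's weights at the finest slice; a hypothesis, NOT PRINTED).  Then run
B's block is sandwiched against `a` with the lower bound untouched and the upper bound widened by `log(1 + ω)`.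
(ALTERNATIVE packaging, node U5.E's choice: split such members off as run-B-only terms of the BAD class of
`T4WeightBudget.hybridSandwich_of_relWeightBound` — a finest-level large-field region still present at the final step is
the OLDEST region of the run, cell record `t4/T4-EST-U5c.md`.) [folklore] -/
theorem of_extra {ω : ℝ} (h : Sandwiched lo hi a g) (hω : 0 ≤ ω) (hx : x ≤ ENNReal.ofReal ω * g) :
    Sandwiched lo (hi + Real.log (1 + ω)) a (g + x) := by
  have hω1 : 0 < 1 + ω := by linarith
  constructor
  · exact h.1.trans le_self_add
  · calc g + x ≤ g + ENNReal.ofReal ω * g := add_le_add le_rfl hx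
      _ = ENNReal.ofReal (1 + ω) * g := by
          rw [ENNReal.ofReal_add zero_le_one hω, ENNReal.ofReal_one, add_mul, one_mul]
      _ ≤ ENNReal.ofReal (1 + ω) * (ENNReal.ofReal (Real.exp hi) * a) := mul_le_mul' le_rfl h.2
      _ = ENNReal.ofReal (Real.exp (hi + Real.log (1 + ω))) * a := by
          rw [← mul_assoc, ← ENNReal.ofReal_mul hω1.le, Real.exp_add, Real.exp_log hω1, mul_comm (1 + ω)]

/-- **THE INNER THRESHOLD SHELL AT LEAF LEVEL — TWO-SIDED EXTRA MASS** (the row's why-it-might-fail: an inner small-field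
radius that is run-dependent): each run's block = a COMMON-CORE part (`a₀`, `b₀`: both runs cut at the common core radius,
sandwiched) plus its OWN shell piece (`xA ≤ ω_A·a₀`, `xB ≤ ω_B·b₀` — the relative masses of the two threshold shells
INSIDE the pending integral; NOT PRINTED).  Then the blocks are sandwiched with bounds widened by `log(1 + ω_A)` below and
`log(1 + ω_B)` above — the one-level-down analogue of `T4IndicatorShell.ShellWeightBound`; with node U5a's common radii at
every pending level `xA = xB = 0`. [folklore] -/
theorem of_shell {ωA ωB : ℝ} (h : Sandwiched lo hi a₀ b₀) (hωA : 0 ≤ ωA) (hωB : 0 ≤ ωB)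
    (hxA : xA ≤ ENNReal.ofReal ωA * a₀) (hxB : xB ≤ ENNReal.ofReal ωB * b₀) :
    Sandwiched (lo - Real.log (1 + ωA)) (hi + Real.log (1 + ωB)) (a₀ + xA) (b₀ + xB) := by
  have hA1 : 0 < 1 + ωA := by linarith
  have hup : Sandwiched lo (hi + Real.log (1 + ωB)) a₀ (b₀ + xB) := of_extra h hωB hxB
  constructor
  · calc ENNReal.ofReal (Real.exp (lo - Real.log (1 + ωA))) * (a₀ + xA)
          ≤ ENNReal.ofReal (Real.exp (lo - Real.log (1 + ωA))) * (ENNReal.ofReal (1 + ωA) * a₀) := by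
            refine mul_le_mul' le_rfl ?_
            calc a₀ + xA ≤ a₀ + ENNReal.ofReal ωA * a₀ := add_le_add le_rfl hxA
              _ = ENNReal.ofReal (1 + ωA) * a₀ := by
                  rw [ENNReal.ofReal_add zero_le_one hωA, ENNReal.ofReal_one, add_mul, one_mul]
      _ = ENNReal.ofReal (Real.exp lo) * a₀ := by
            rw [← mul_assoc, ← ENNReal.ofReal_mul (Real.exp_nonneg _), Real.exp_sub, Real.exp_log hA1,
              div_mul_cancel₀ _ hA1.ne']
      _ ≤ b₀ := h.1
      _ ≤ b₀ + xB := le_self_add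
  · exact hup.2.trans (mul_le_mul' le_rfl le_self_add)

end Sandwiched

/-- HYPOTHESIS SHAPE — NODE U5a AT EVERY PENDING LEVEL as a binder: on the designated set `N` of leaves (characteristic
functions, δ-functions, measure densities at all nesting levels) the two runs' leaf values are IDENTICAL functions of the
configuration (common radii, common gauge graphs, common boxes; cell record X-16 D3/D4, tree `T4SyncThresholds`).  NOT
PRINTED — a hypothesis of node U5.E. [folklore] -/
def SyncLeaves {ι W : Type*} (N : Set ι) (fA fB : ι → W → ℝ≥0∞) : Prop :=
  ∀ i ∈ N, fA i = fB i

/-- Synchronised leaves are matched with any sign-normalised bounds. [folklore] -/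
theorem matched_leaf_of_sync {ι O W : Type*} {N : Set ι} {fA fB : ι → W → ℝ≥0∞} (h : SyncLeaves N fA fB)
    (T : O → PosOp W) {l u : ι → ℝ} {i : ι} (hi : i ∈ N) (hl : l i ≤ 0) (hu : 0 ≤ u i) (w : W) :
    Ledger.Matched T fA fB l u (Ledger.leaf i) w := by
  show Sandwiched (l i) (u i) (fA i w) (fB i w)
  rw [h i hi]
  exact Sandwiched.rfl_of hl hu _

end Leaves

end

end Literature.MathematicalPhysics.QuantumFieldTheory.Balaban1983to89.T4NestedLevels
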